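/-
Copyright (c) 2026. All rights reserved.
Released under Apache 2.0 license as described in the file LICENSE.
Authors: abc-iut cell, seat abc-iut-w5-d226 (gen 3; consumer glue for GAP G-w5d226-2 «G-P13-GR»).
-/
import Literature.AnabelianGeometry.SemiGraphs.PSCGraphicProofs
import HarnessLib

/-!
# [CombGC] Def 1.4 (i): graphicity is insensitive to inner automorphisms

Mochizuki, *A combinatorial version of the Grothendieck conjecture* [CombGC] (bib `MochizukiCombGC2007`),
Def 1.1 (ii) pp. 6–7 ("a vertex (respectively, edge) of `𝔾` determines, UP TO CONJUGATION, a closed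
subgroup") and Def 1.4 (i) p. 10 ("`α` is graphic if it arises from an isomorphism of semi-graphs of
anabelioids") — since verticial / edge-like subgroups are only conjugacy CLASSES, graphicity of an
isomorphism `α : Π_G ≅ Π_H` (layer L3's `PSCDatum.IsGraphic`, `PSCDatum.IsGraphicVia`) depends only on its
class modulo inner automorphisms of `Π_H`; in particular every inner automorphism of `Π_G` is graphic
(via the identity of the underlying semi-graph).

PROOF-ONLY (no definitions).  Consumer: the hypothesis `hgr` of abc-iut-L4's
`DPSCData.graphic_vertSub_of_psc` ([AbsTopII] Def 1.2 (ii) "`ρ_H : H → Aut(𝒢) ⊆ Out(Π_𝒢)`",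
`AbsTopII/DPSCDataOfSemiGraphGraphic.lean`) asks that conjugation by every `h ∈ Π_H = Π_𝒢 ⋊^out H` be
graphic on `Π_𝒢`; by `IsGraphicVia.of_conj_comp` this only depends on the image of `h` in `H`, and by
`isGraphic_of_inner` it holds on `Π_𝒢` itself.  Nothing here bears on [IUTchIII] Cor. 3.12.
-/

namespace Literature.AnabelianGeometry.SemiGraphs

namespace PSCDatum

open scoped Pointwise

universe u

variable {P : Type u} [Group P] [TopologicalSpace P] {P' : Type u} [Group P'] [TopologicalSpace P']

/-- Images along `x ↦ p'·α(x)·p'⁻¹` are the `p'`-conjugates of images along `α`.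
[cite: MochizukiCombGC2007, Def 1.1(ii) p.6] -/
theorem map_eq_conjAct_smul_map_of_conj (α α' : P ≃ₜ* P') (p' : P')
    (hα' : ∀ x, α' x = p' * α x * p'⁻¹) (K : Subgroup P) :
    K.map α'.toMulEquiv.toMonoidHom = ConjAct.toConjAct p' • K.map α.toMulEquiv.toMonoidHom := by
  have hcomp : α'.toMulEquiv.toMonoidHom = (MulAut.conj p').toMonoidHom.comp α.toMulEquiv.toMonoidHom := by
    ext x; exact hα' x
  rw [hcomp, ← Subgroup.map_map]
  ext y
  simp only [Subgroup.mem_map, MulEquiv.coe_toMonoidHom, MulAut.conj_apply,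
    Subgroup.mem_pointwise_smul_iff_inv_smul_mem, ← map_inv, ConjAct.toConjAct_smul_eq_mulAut_conj]
  constructor
  · rintro ⟨z, hz, rfl⟩
    simpa [mul_assoc] using hz
  · intro h
    exact ⟨p'⁻¹ * y * p'⁻¹⁻¹, h, by simp [mul_assoc]⟩

/-- **Graphicity is invariant under composition with an inner automorphism of the target**: if `α` is
graphic via `ι`, so is every `α'` with `α'(x) = p'·α(x)·p'⁻¹` ([CombGC] Def 1.4 (i): the verticial and
edge-like subgroups are conjugacy classes, Def 1.1 (ii)). [cite: MochizukiCombGC2007, Def 1.4(i) p.10] -/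
theorem IsGraphicVia.of_conj_comp {G : PSCDatum P} {H : PSCDatum P'} {α : P ≃ₜ* P'}
    {ι : PSCSemiGraph.Iso G.graph H.graph} (h : G.IsGraphicVia H α ι) (p' : P') (α' : P ≃ₜ* P')
    (hα' : ∀ x, α' x = p' * α x * p'⁻¹) : G.IsGraphicVia H α' ι := by
  obtain ⟨hV, hN, hC⟩ := h
  refine ⟨fun v => ?_, fun e => ?_, fun c => ?_⟩
  · obtain ⟨γ, hγ⟩ := hV v
    exact ⟨ConjAct.toConjAct p' * γ, by rw [map_eq_conjAct_smul_map_of_conj α α' p' hα', hγ, mul_smul]⟩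
  · obtain ⟨γ, hγ⟩ := hN e
    exact ⟨ConjAct.toConjAct p' * γ, by rw [map_eq_conjAct_smul_map_of_conj α α' p' hα', hγ, mul_smul]⟩
  · obtain ⟨γ, hγ⟩ := hC c
    exact ⟨ConjAct.toConjAct p' * γ, by rw [map_eq_conjAct_smul_map_of_conj α α' p' hα', hγ, mul_smul]⟩

/-- **Graphicity is invariant under inner automorphisms of the target.**
[cite: MochizukiCombGC2007, Def 1.4(i) p.10] -/
theorem IsGraphic.of_conj_comp {G : PSCDatum P} {H : PSCDatum P'} {α : P ≃ₜ* P'} (h : G.IsGraphic H α)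
    (p' : P') (α' : P ≃ₜ* P') (hα' : ∀ x, α' x = p' * α x * p'⁻¹) : G.IsGraphic H α' := by
  obtain ⟨ι, hι⟩ := h
  exact ⟨ι, hι.of_conj_comp p' α' hα'⟩

/-- **Inner automorphisms are graphic** (via the identity of the underlying semi-graph): every
continuous automorphism of `Π_G` that is conjugation by an element of `Π_G` is graphic.
[cite: MochizukiCombGC2007, Def 1.4(i) p.10] -/
theorem isGraphic_of_inner (G : PSCDatum P) (p : P) (α : P ≃ₜ* P) (hα : ∀ x, α x = p * x * p⁻¹) :
    G.IsGraphic G α :=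
  (isGraphic_refl G).of_conj_comp p α (fun x => by simpa using hα x)

end PSCDatum

end Literature.AnabelianGeometry.SemiGraphs
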